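/-
Copyright (c) 2026 the pub-hodgecm-mathlib formalisation cell (harness21).  Prover seat hodgecm-mathlib-K2E3-p25 (g4), Track B «K2-LIT»,
#184♮ = hLiu418 = `stmt-HodgeConjecture-24832`; F4 (G-gen) road (E), (E-g) partner letter: seam S1 of the `hfin`∕`hread` plug (F4 desk K2Liu-p27 (g3) WORD #3 (3)
2026-09-05T00:44:59Z «(S1-brick)»; K2E5-r02 (g7) PRE-BOX (S1) 00:43:18Z + (N1)–(N3) 00:48:28Z; LH7-p05 (g2) `hread_of_frameUnitary … (hKU)` 00:47:57Z): THE FRAME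
UNITARITY OF THE ARCH LEG — the phase map of Folland's section of `𝕎 = 𝔻 ⊗ V′` at `(k ⊗ 1)_∞` is a REALIFIED UNITARY for every `k` in the sign-frame compact class of `𝔻`
(letter `hKU`, discharged from the closure letter `hK₀`).  THEOREMS ONLY (no `def`, no `instance`, no notation, no named-fact hypothesis, no `sorry`).
-/
import Summits.HodgeConjecture.HodgeConjecture.Theorems.K2LiuArchTensorKTypeComponents     -- ★ the left leg for EVERY `k`: `archUFormPi_tensorEmb`
import Summits.HodgeConjecture.HodgeConjecture.Theorems.K2LiuJunctionCompactPairKType       -- ★ `exists_kV_eq_relabel_toBig_kV_one`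
import Summits.HodgeConjecture.HodgeConjecture.Theorems.K2LiuArchJunctionFrameData          -- ★ `exists_junctionFrameData`
import Summits.HodgeConjecture.HodgeConjecture.Theorems.K2LiuSignBlockCompactPlaceSec       -- ★ `archUFormPi_mem_range_iff_mem_closure`
import Summits.HodgeConjecture.HodgeConjecture.Theorems.K2LiuTensorEmbArchFinParts          -- ★ `archPart_tensorEmb` (`(k ⊗ 1)_∞ = ((k_∞,1) ⊗ 1)_∞`)
import Literature.NumberTheory.Weil1964.ArchUnitaryWeilHalfCompact                         -- ★ `exists_proj_archWeilSectionS_eq_realifySp`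
import Literature.NumberTheory.K2Lit.SiegelStandardIwasawaData                             -- ★ `IwasawaDatum.IsStd.exists_arch`
import HarnessLib

/-!
# Crux `HLiu418`, F4 road (E), (E-g) seam S1: the arch leg `(k ⊗ 1)_∞` of a sign-frame compact `k` has UNITARY Fock phase map (letter `hKU` from `hK₀`)

Cell `hodgecm-mathlib`, crux item hLiu418 = `stmt-HodgeConjecture-24832` (helper lane `--supports`, count-neutral; closes no socket).

THE SEAM.  ★ p863778 `K2LiuArchSWTruncationSectionsFinite.finiteDimensional_span_truncationSections` (LH7-p05) pays the (E-g) partner letter `hfin` from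
`h𝒦 : 𝒦.IsStd` and ONE reading letter `hread`, whose only non-★ ingredient is the FRAME UNITARITY `hKU : ∀ k ∈ 𝒦.K, ∃ u, MpS.proj (archWeilSectionS_𝕎 ((k ⊗ 1)_∞)) =
realifySp σ′ u` (`σ′ = Fin (n′+n′) × {v real}`; ★ (β) p863624's `hxu`, ★ p863184 `degTrunc_carrierConjEquiv_of_proj_eq_realifySp`'s `hx`) — true exactly for the
SIGN-FRAME-ADAPTED arch class (RULING M-160c; K2E5-r02 (N3)).  This file pays it from the closure letter `hK₀` of ★ `K2LiuArchPlaceSecFockDegree.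
isArchDatum_hermiteSpan_of_closure_kV` (the letter F4-END already binds, ★ `K2LiuIwasawaDatumOfRecordSignFrames.hK₀_of_archClass`):
* §1 **`archUFormPi_tensorEmb_mem_range`** — if every sign-frame component of `k ∈ H(L⁺ ⊗ ℝ)` is sign-block compact (`archUFormPi_𝔻 k σ ∈ range kV` for all `σ`), then so is
  every sign-frame component of `(k ⊗ 1)_∞ ∈ U(𝕎)(L⁺ ⊗ ℝ)` (★ left leg `K2LiuArchTensorKTypeComponents.archUFormPi_tensorEmb` at the junction frames of ★
  `exists_junctionFrameData` + ★ `K2LiuJunctionCompactPairKType.exists_kV_eq_relabel_toBig_kV_one`);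
* §2 **`exists_proj_archWeilSectionS_tensorEmb_eq_realifySp`** — hence the phase map of Folland's section of `𝕎` at `(k ⊗ 1)_∞` is `realifySp σ′ u` for a unitary `u`
  (★ Lit. `exists_proj_archWeilSectionS_eq_realifySp`); **`…_of_mem_closure`** — the same for `k ∈ Submonoid.closure {placeSec_𝔻 σ (kV k₁)}` (★
  `K2LiuSignBlockCompactPlaceSec.archUFormPi_mem_range_iff_mem_closure`);
* §3 **`hKU_of_hK₀`** — THE LETTER: for a standard Iwasawa datum `𝒦` with the closure letter `hK₀` (bytes of ★ `isArchDatum_hermiteSpan_of_closure_kV` VERBATIM),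
  `∀ k ∈ 𝒦.K, ∃ u, MpS.proj (archWeilSectionS_𝕎 (archPart (tensorEmb k))) = realifySp σ′ u` (`(k ⊗ 1)_∞ = ((k_∞, 1) ⊗ 1)_∞`, ★ `archPart_tensorEmb`; `(k_∞, 1) ∈ 𝒦.K` by ★
  `IsStd.exists_arch`).
References: [Folland1989, §4.2 Prop. (4.39)]; [Weil1964, Chap. III n° 37]; [KonnoKonno2007, §3.1 (3.1), Lemma 5.2]; [BorelJacquet1979, §4.1]; [Kudla1994, §2].
HONEST LABEL: HC_CM is proved only modulo the 7 printed citations (2 remaining named inputs: hLiu418 = stmt-HodgeConjecture-24832,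
h413 = stmt-HodgeConjecture-24833) until rung 0 closes; count-neutral helper, closes no socket; `hKU` holds for sign-frame-adapted classes only (do not advertise it for every
standard `𝒦`).
-/

set_option autoImplicit false
set_option linter.dupNamespace false -- the mandated namespace repeats `HodgeConjecture.HodgeConjecture`

noncomputable section

open scoped Matrix Kronecker Classical
open NumberField NumberField.InfinitePlace NumberField.mixedEmbedding IsDedekindDomain

namespace Summit.HodgeConjecture.HodgeConjecture.Cruxes.HLiu418.K2LiuArchFrameCompactReading

open Literature.NumberTheory.Automorphic Literature.NumberTheory.Automorphic.UnitaryGroup Literature.NumberTheory.Weil1964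
open Literature.NumberTheory.Weil1964.MpS Literature.NumberTheory.Weil1964.UnitaryWeil
open Literature.NumberTheory.GelbartRogawski1991 Literature.NumberTheory.GelbartRogawski1991.UnitaryDualPair
open Literature.NumberTheory.GelbartRogawski1991.UnitaryDualPair.LocalSplitting
open Literature.NumberTheory.GelbartRogawski1991.GRConstruction Literature.NumberTheory.K2Lit.SiegelDoubled
open Literature.RepresentationTheory.HeisenbergGroup Literature.Analysis.SegalBargmann
open Literature.RepresentationTheory.KonnoKonno2007 Literature.RepresentationTheory.KonnoKonno2007.RealDualPair
open Summit.HodgeConjecture.HodgeConjecture.Cruxes.HLiu418 Summit.HodgeConjecture.HodgeConjecture.Cruxes.HLiu418.K2LiuArchSectionPlaceBlock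

variable (L : Type) [Field L] [NumberField L] [IsCMField L]
variable {N M n : ℕ} (e : Fin N × Fin M ≃ Fin n)
  (dV : Fin N → L) (hdV : ∀ i, IsCMField.complexConj L (dV i) = dV i) (hdV0 : ∀ i, dV i ≠ 0)
  (dW : Fin M → L) (hdW : ∀ i, IsCMField.complexConj L (dW i) = dW i) (hdW0 : ∀ i, dW i ≠ 0)
variable {M₂ M' n' : ℕ} (eW : Fin M × Fin M₂ ≃ Fin M') (e' : Fin N × Fin M' ≃ Fin n')
  (dV' : Fin M₂ → L) (hdV' : ∀ k, IsCMField.complexConj L (dV' k) = dV' k) (hdV'0 : ∀ k, dV' k ≠ 0)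

-- the CM sign frames of the big datum elaborate slowly (as ★ `K2LiuArchJunctionFrameData` ∕ ★ σ15: 4 000 000 heartbeats)
set_option maxHeartbeats 4000000

/-! ## §1 Sign-block compact in ⇒ sign-block compact out -/

include hdV'0 in
/-- **SIGN-BLOCK COMPACT IN ⇒ SIGN-BLOCK COMPACT OUT**: if every sign-frame component of `k ∈ H(L⁺ ⊗ ℝ) = U(𝔻)(L⁺ ⊗ ℝ)` lies in the maximal compact `U(𝔻⁺_σ) × U(𝔻⁻_σ)`
(`∈ range kV`), then every sign-frame component of `(k ⊗ 1)_∞ ∈ U(𝕎)(L⁺ ⊗ ℝ)` lies in `U(𝕎⁺_σ) × U(𝕎⁻_σ)` (★ left leg `archUFormPi_tensorEmb` at the junction frames of ★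
`exists_junctionFrameData`; the relabelled junction image of `(kV (a,b), 1)` is `kV (A, B)`, ★ `exists_kV_eq_relabel_toBig_kV_one`).
[cite: KonnoKonno2007, §3.1 (3.1), Lemma 5.2] [cite: Kudla1994, §2 (doubled space, Siegel parabolic)] -/
theorem archUFormPi_tensorEmb_mem_range (k : UnitaryGroup.arch (Fp L) L (IsCMField.complexConj L) (n + n) (hermD L e dV hdV dW hdW))
    (hk : ∀ σ : {v : InfinitePlace (Fp L) // v.IsReal}, archUFormPi L (IsCMField.complexConj L) (n + n) (IsCMField.complexConj_ne_one L) (cmPlaceOver L) (cmPlaceOver_smul L) (cmPlaceOver_comap L)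
        (fun k => Sum.elim (cmGramEntry L e dV hdV dW hdW) (-cmGramEntry L e dV hdV dW hdW) ((LocalSplitting.e₂ n).symm k))
        (gramD_gram_realDiagonal_entry_ne_zero L e dV hdV dW hdW hdV0 hdW0) (gramD_eq_diagonal_cm L e dV hdV dW hdW) (J := hermD L e dV hdV dW hdW) rfl
        (complexConj_imagUnit L) (imagUnit_ne_zero L) k σ ∈
        (UForm.kV (PosIdx (signVec (cmPlaceOver L) (fun k => Sum.elim (cmGramEntry L e dV hdV dW hdW) (-cmGramEntry L e dV hdV dW hdW) ((LocalSplitting.e₂ n).symm k)) (imagUnit L) σ))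
          (NegIdx (signVec (cmPlaceOver L) (fun k => Sum.elim (cmGramEntry L e dV hdV dW hdW) (-cmGramEntry L e dV hdV dW hdW) ((LocalSplitting.e₂ n).symm k)) (imagUnit L) σ))).range)
    (σ : {v : InfinitePlace (Fp L) // v.IsReal}) :
    archUFormPi L (IsCMField.complexConj L) (n' + n') (IsCMField.complexConj_ne_one L) (cmPlaceOver L) (cmPlaceOver_smul L) (cmPlaceOver_comap L)
        (fun k => Sum.elim (cmGramEntry L e' dV hdV (tensorFrame L dW eW dV') (tensorFrame_real L dW hdW eW dV' hdV')) (-cmGramEntry L e' dV hdV (tensorFrame L dW eW dV') (tensorFrame_real L dW hdW eW dV' hdV')) ((LocalSplitting.e₂ n').symm k))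
        (gramD_gram_realDiagonal_entry_ne_zero L e' dV hdV (tensorFrame L dW eW dV') (tensorFrame_real L dW hdW eW dV' hdV') hdV0 (tensorFrame_ne_zero L dW eW dV' hdW0 hdV'0))
        (gramD_eq_diagonal_cm L e' dV hdV (tensorFrame L dW eW dV') (tensorFrame_real L dW hdW eW dV' hdV'))
        (J := hermD L e' dV hdV (tensorFrame L dW eW dV') (tensorFrame_real L dW hdW eW dV' hdV')) rfl (complexConj_imagUnit L) (imagUnit_ne_zero L)
        (UnitaryGroup.archPart (Fp L) L (IsCMField.complexConj L) (n' + n') (hermD L e' dV hdV (tensorFrame L dW eW dV') (tensorFrame_real L dW hdW eW dV' hdV'))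
          (tensorEmb L e dV hdV dW hdW eW e' dV' hdV' (UnitaryGroup.archToAdelic (Fp L) L (IsCMField.complexConj L) (n + n) (hermD L e dV hdV dW hdW) k))) σ ∈
      (UForm.kV (PosIdx (signVec (cmPlaceOver L) (fun k => Sum.elim (cmGramEntry L e' dV hdV (tensorFrame L dW eW dV') (tensorFrame_real L dW hdW eW dV' hdV')) (-cmGramEntry L e' dV hdV (tensorFrame L dW eW dV') (tensorFrame_real L dW hdW eW dV' hdV')) ((LocalSplitting.e₂ n').symm k)) (imagUnit L) σ))
        (NegIdx (signVec (cmPlaceOver L) (fun k => Sum.elim (cmGramEntry L e' dV hdV (tensorFrame L dW eW dV') (tensorFrame_real L dW hdW eW dV' hdV')) (-cmGramEntry L e' dV hdV (tensorFrame L dW eW dV') (tensorFrame_real L dW hdW eW dV' hdV')) ((LocalSplitting.e₂ n').symm k)) (imagUnit L) σ))).range := by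
  -- the junction frames at `σ` (★ FrameData; the `∃`-bound `y` suffices here)
  obtain ⟨y, hy, hz, eP, eQ, hE⟩ := K2LiuArchJunctionFrameData.exists_junctionFrameData L e dV hdV hdV0 dW hdW hdW0 eW e' dV' hdV' hdV'0
  rw [K2LiuArchTensorKTypeComponents.archUFormPi_tensorEmb L e dV hdV dW hdW eW e' dV' hdV' hdV0 hdW0 hdV'0 σ k (y σ) (hy σ) (hz σ) (eP σ) (eQ σ) (hE σ)]
  obtain ⟨⟨a, b⟩, hab⟩ := hk σ
  rw [← hab]
  obtain ⟨K, hK, -, -⟩ := K2LiuJunctionCompactPairKType.exists_kV_eq_relabel_toBig_kV_one (R := PosIdx (y σ)) (S := NegIdx (y σ)) a b (eP σ) (eQ σ)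
  exact ⟨K, hK.symm⟩

/-! ## §2 The Fock phase map of Folland's section at `(k ⊗ 1)_∞` is a realified unitary -/

include hdV'0 in
/-- **FRAME UNITARITY OF THE ARCH LEG at a sign-frame compact `k`**: if every sign-frame component of `k ∈ H(L⁺ ⊗ ℝ)` is sign-block compact, the phase map of Folland's
section of the big datum `𝕎` at `(k ⊗ 1)_∞` is `realifySp σ′ u` for a unitary `u` of `ℂ^{σ′}`, `σ′ = Fin (n′+n′) × {v real}` (§1 + ★ Lit.
`exists_proj_archWeilSectionS_eq_realifySp`). [cite: Folland1989, §4.2 Prop. (4.39)] [cite: Weil1964, Chap. III n° 37] [cite: KonnoKonno2007, §3.1 (3.1)] -/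
theorem exists_proj_archWeilSectionS_tensorEmb_eq_realifySp (k : UnitaryGroup.arch (Fp L) L (IsCMField.complexConj L) (n + n) (hermD L e dV hdV dW hdW))
    (hk : ∀ σ : {v : InfinitePlace (Fp L) // v.IsReal}, archUFormPi L (IsCMField.complexConj L) (n + n) (IsCMField.complexConj_ne_one L) (cmPlaceOver L) (cmPlaceOver_smul L) (cmPlaceOver_comap L)
        (fun k => Sum.elim (cmGramEntry L e dV hdV dW hdW) (-cmGramEntry L e dV hdV dW hdW) ((LocalSplitting.e₂ n).symm k))
        (gramD_gram_realDiagonal_entry_ne_zero L e dV hdV dW hdW hdV0 hdW0) (gramD_eq_diagonal_cm L e dV hdV dW hdW) (J := hermD L e dV hdV dW hdW) rfl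
        (complexConj_imagUnit L) (imagUnit_ne_zero L) k σ ∈
        (UForm.kV (PosIdx (signVec (cmPlaceOver L) (fun k => Sum.elim (cmGramEntry L e dV hdV dW hdW) (-cmGramEntry L e dV hdV dW hdW) ((LocalSplitting.e₂ n).symm k)) (imagUnit L) σ))
          (NegIdx (signVec (cmPlaceOver L) (fun k => Sum.elim (cmGramEntry L e dV hdV dW hdW) (-cmGramEntry L e dV hdV dW hdW) ((LocalSplitting.e₂ n).symm k)) (imagUnit L) σ))).range) :
    ∃ u : Matrix.unitaryGroup (Fin (n' + n') × {v : InfinitePlace (Fp L) // v.IsReal}) ℂ,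
      MpS.proj (archWeilSectionS L (IsCMField.complexConj L) (n' + n') (IsCMField.complexConj_ne_one L) (cmPlaceOver L) (cmPlaceOver_smul L) (cmPlaceOver_comap L) _
          (gramD_gram_realDiagonal_entry_ne_zero L e' dV hdV (tensorFrame L dW eW dV') (tensorFrame_real L dW hdW eW dV' hdV') hdV0 (tensorFrame_ne_zero L dW eW dV' hdW0 hdV'0))
          (gramD_eq_diagonal_cm L e' dV hdV (tensorFrame L dW eW dV') (tensorFrame_real L dW hdW eW dV' hdV'))
          (J := hermD L e' dV hdV (tensorFrame L dW eW dV') (tensorFrame_real L dW hdW eW dV' hdV')) rfl (complexConj_imagUnit L) (imagUnit_ne_zero L)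
          (UnitaryGroup.archPart (Fp L) L (IsCMField.complexConj L) (n' + n') (hermD L e' dV hdV (tensorFrame L dW eW dV') (tensorFrame_real L dW hdW eW dV' hdV'))
            (tensorEmb L e dV hdV dW hdW eW e' dV' hdV' (UnitaryGroup.archToAdelic (Fp L) L (IsCMField.complexConj L) (n + n) (hermD L e dV hdV dW hdW) k)))) =
        realifySp (Fin (n' + n') × {v : InfinitePlace (Fp L) // v.IsReal}) u := by
  have h := fun σ => MonoidHom.mem_range.1 (archUFormPi_tensorEmb_mem_range L e dV hdV hdV0 dW hdW hdW0 eW e' dV' hdV' hdV'0 k hk σ)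
  choose K hK using h
  exact exists_proj_archWeilSectionS_eq_realifySp L (IsCMField.complexConj L) (n' + n') (IsCMField.complexConj_ne_one L) (cmPlaceOver L) (cmPlaceOver_smul L)
    (cmPlaceOver_comap L) _
    (gramD_gram_realDiagonal_entry_ne_zero L e' dV hdV (tensorFrame L dW eW dV') (tensorFrame_real L dW hdW eW dV' hdV') hdV0 (tensorFrame_ne_zero L dW eW dV' hdW0 hdV'0))
    (gramD_eq_diagonal_cm L e' dV hdV (tensorFrame L dW eW dV') (tensorFrame_real L dW hdW eW dV' hdV'))
    (J := hermD L e' dV hdV (tensorFrame L dW eW dV') (tensorFrame_real L dW hdW eW dV' hdV')) rfl (complexConj_imagUnit L) (imagUnit_ne_zero L) _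
    (fun σ => (K σ).1) (fun σ => (K σ).2) (fun σ => (hK σ).symm)

include hdV'0 in
/-- **… for every `k` of the sign-frame compact class** `Submonoid.closure {placeSec_𝔻 σ (kV k₁) | σ real, k₁ ∈ U(𝔻⁺_σ) × U(𝔻⁻_σ)}` (the `hK₀` currency of ★ σ15 ∕ ★
`isArchDatum_hermiteSpan_of_closure_kV`; ★ `archUFormPi_mem_range_iff_mem_closure`). [cite: Folland1989, §4.2 Prop. (4.39)] [cite: KonnoKonno2007, §3.1 (3.1)]
[cite: BorelJacquet1979, §4.1] -/
theorem exists_proj_archWeilSectionS_tensorEmb_eq_realifySp_of_mem_closure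
    (k : UnitaryGroup.arch (Fp L) L (IsCMField.complexConj L) (n + n) (hermD L e dV hdV dW hdW))
    (hk : k ∈ Submonoid.closure {k : UnitaryGroup.arch (Fp L) L (IsCMField.complexConj L) (n + n) (hermD L e dV hdV dW hdW) |
        ∃ (σ : {v : InfinitePlace (Fp L) // v.IsReal}) (k₁ : Matrix.unitaryGroup (PosIdx (signVec (cmPlaceOver L) (fun k => Sum.elim (cmGramEntry L e dV hdV dW hdW) (-cmGramEntry L e dV hdV dW hdW) ((LocalSplitting.e₂ n).symm k)) (imagUnit L) σ)) ℂ × Matrix.unitaryGroup (NegIdx (signVec (cmPlaceOver L) (fun k => Sum.elim (cmGramEntry L e dV hdV dW hdW) (-cmGramEntry L e dV hdV dW hdW) ((LocalSplitting.e₂ n).symm k)) (imagUnit L) σ)) ℂ),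
          k = placeSec L (IsCMField.complexConj L) (n + n) (IsCMField.complexConj_ne_one L) (cmPlaceOver L) (cmPlaceOver_smul L) (fun k => Sum.elim (cmGramEntry L e dV hdV dW hdW) (-cmGramEntry L e dV hdV dW hdW) ((LocalSplitting.e₂ n).symm k))
          (gramD_gram_realDiagonal_entry_ne_zero L e dV hdV dW hdW hdV0 hdW0) (complexConj_imagUnit L) (imagUnit_ne_zero L) σ
          (cmPlaceOver_comap L) (gramD_eq_diagonal_cm L e dV hdV dW hdW) (J := hermD L e dV hdV dW hdW) rfl
          (complexConj_smul_infinitePlace L) (UForm.kV _ _ k₁)}) :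
    ∃ u : Matrix.unitaryGroup (Fin (n' + n') × {v : InfinitePlace (Fp L) // v.IsReal}) ℂ,
      MpS.proj (archWeilSectionS L (IsCMField.complexConj L) (n' + n') (IsCMField.complexConj_ne_one L) (cmPlaceOver L) (cmPlaceOver_smul L) (cmPlaceOver_comap L) _
          (gramD_gram_realDiagonal_entry_ne_zero L e' dV hdV (tensorFrame L dW eW dV') (tensorFrame_real L dW hdW eW dV' hdV') hdV0 (tensorFrame_ne_zero L dW eW dV' hdW0 hdV'0))
          (gramD_eq_diagonal_cm L e' dV hdV (tensorFrame L dW eW dV') (tensorFrame_real L dW hdW eW dV' hdV'))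
          (J := hermD L e' dV hdV (tensorFrame L dW eW dV') (tensorFrame_real L dW hdW eW dV' hdV')) rfl (complexConj_imagUnit L) (imagUnit_ne_zero L)
          (UnitaryGroup.archPart (Fp L) L (IsCMField.complexConj L) (n' + n') (hermD L e' dV hdV (tensorFrame L dW eW dV') (tensorFrame_real L dW hdW eW dV' hdV'))
            (tensorEmb L e dV hdV dW hdW eW e' dV' hdV' (UnitaryGroup.archToAdelic (Fp L) L (IsCMField.complexConj L) (n + n) (hermD L e dV hdV dW hdW) k)))) =
        realifySp (Fin (n' + n') × {v : InfinitePlace (Fp L) // v.IsReal}) u :=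
  exists_proj_archWeilSectionS_tensorEmb_eq_realifySp L e dV hdV hdV0 dW hdW hdW0 eW e' dV' hdV' hdV'0 k
    ((K2LiuSignBlockCompactPlaceSec.archUFormPi_mem_range_iff_mem_closure L e dV hdV hdV0 dW hdW hdW0 k).2 hk)

/-! ## §3 The letter `hKU` for a standard Iwasawa datum on the sign-frame arch class -/

include hdV'0 in
/-- **THE LETTER `hKU` FROM THE CLOSURE LETTER `hK₀`** (★ p863778's ∕ LH7-p05 `hread_of_frameUnitary`'s ONE residual letter): for a STANDARD Iwasawa datum `𝒦` of `H(𝔸)`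
whose archimedean elements lie in the sign-frame compact class (`hK₀`, bytes of ★ `isArchDatum_hermiteSpan_of_closure_kV` VERBATIM — the letter F4-END binds through ★
`K2LiuIwasawaDatumOfRecordSignFrames.hK₀_of_archClass`), EVERY `k ∈ 𝒦.K` has an arch leg `(k ⊗ 1)_∞` whose Fock phase map is a realified unitary:
`∃ u, MpS.proj (archWeilSectionS_𝕎 (archPart (tensorEmb k))) = realifySp σ′ u` (`(k ⊗ 1)_∞ = ((k_∞,1) ⊗ 1)_∞`, ★ `archPart_tensorEmb`; `(k_∞,1) ∈ 𝒦.K`, ★ `IsStd.exists_arch`; §2).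
[cite: Folland1989, §4.2 Prop. (4.39)] [cite: Weil1964, Chap. III n° 37] [cite: BorelJacquet1979, §4.1] [cite: KonnoKonno2007, §3.1 (3.1)] -/
theorem hKU_of_hK₀ (𝒦 : IwasawaDatum L e dV hdV dW hdW) (h𝒦 : 𝒦.IsStd)
    (hK₀ : ∀ ainf : UnitaryGroup.arch (Fp L) L (IsCMField.complexConj L) (n + n) (hermD L e dV hdV dW hdW),
      (UnitaryGroup.archToAdelic (Fp L) L (IsCMField.complexConj L) (n + n) (hermD L e dV hdV dW hdW) ainf : HA L e dV hdV dW hdW) ∈ 𝒦.K →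
      ainf ∈ Submonoid.closure {k : UnitaryGroup.arch (Fp L) L (IsCMField.complexConj L) (n + n) (hermD L e dV hdV dW hdW) |
        ∃ (σ : {v : InfinitePlace (Fp L) // v.IsReal}) (k₁ : Matrix.unitaryGroup (PosIdx (signVec (cmPlaceOver L) (fun k => Sum.elim (cmGramEntry L e dV hdV dW hdW) (-cmGramEntry L e dV hdV dW hdW) ((LocalSplitting.e₂ n).symm k)) (imagUnit L) σ)) ℂ × Matrix.unitaryGroup (NegIdx (signVec (cmPlaceOver L) (fun k => Sum.elim (cmGramEntry L e dV hdV dW hdW) (-cmGramEntry L e dV hdV dW hdW) ((LocalSplitting.e₂ n).symm k)) (imagUnit L) σ)) ℂ),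
          k = (placeSec L (IsCMField.complexConj L) (n + n) (IsCMField.complexConj_ne_one L) (cmPlaceOver L) (cmPlaceOver_smul L) _
          (gramD_gram_realDiagonal_entry_ne_zero L e dV hdV dW hdW hdV0 hdW0) (complexConj_imagUnit L) (imagUnit_ne_zero L) σ
          (cmPlaceOver_comap L) (gramD_eq_diagonal_cm L e dV hdV dW hdW) (J := hermD L e dV hdV dW hdW) rfl
          (complexConj_smul_infinitePlace L) (UForm.kV _ _ k₁))}) :
    ∀ k ∈ 𝒦.K, ∃ u : Matrix.unitaryGroup (Fin (n' + n') × {v : InfinitePlace (Fp L) // v.IsReal}) ℂ,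
      MpS.proj (archWeilSectionS L (IsCMField.complexConj L) (n' + n') (IsCMField.complexConj_ne_one L) (cmPlaceOver L) (cmPlaceOver_smul L) (cmPlaceOver_comap L) _
          (gramD_gram_realDiagonal_entry_ne_zero L e' dV hdV (tensorFrame L dW eW dV') (tensorFrame_real L dW hdW eW dV' hdV') hdV0 (tensorFrame_ne_zero L dW eW dV' hdW0 hdV'0))
          (gramD_eq_diagonal_cm L e' dV hdV (tensorFrame L dW eW dV') (tensorFrame_real L dW hdW eW dV' hdV'))
          (J := hermD L e' dV hdV (tensorFrame L dW eW dV') (tensorFrame_real L dW hdW eW dV' hdV')) rfl (complexConj_imagUnit L) (imagUnit_ne_zero L)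
          (UnitaryGroup.archPart (Fp L) L (IsCMField.complexConj L) (n' + n') (hermD L e' dV hdV (tensorFrame L dW eW dV') (tensorFrame_real L dW hdW eW dV' hdV'))
            (tensorEmb L e dV hdV dW hdW eW e' dV' hdV' k))) =
        realifySp (Fin (n' + n') × {v : InfinitePlace (Fp L) // v.IsReal}) u := by
  intro k hk
  obtain ⟨Cinf, S, -, -, hCK, hKC⟩ := h𝒦.exists_arch
  -- `(k_∞, 1) ∈ 𝒦.K`, so `k_∞` is in the sign-frame class
  have hmem := hK₀ _ (hCK _ (hKC k hk))
  rw [K2LiuTensorEmbArchFinParts.archPart_tensorEmb L e dV hdV dW hdW eW e' dV' hdV' k]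
  exact exists_proj_archWeilSectionS_tensorEmb_eq_realifySp_of_mem_closure L e dV hdV hdV0 dW hdW hdW0 eW e' dV' hdV' hdV'0 _ hmem

end Summit.HodgeConjecture.HodgeConjecture.Cruxes.HLiu418.K2LiuArchFrameCompactReading

end
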